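import Summits.AtomisticToContinuum.Crystallization.Theses.ReggeStarCoercivity
import Summits.AtomisticToContinuum.Crystallization.Theorems.ReggeStarCoercivityPeriodicStarCoercivityOfStarCoercivity
import Summits.AtomisticToContinuum.Crystallization.Theorems.ReggeStarCoercivityStarCoercivity
import HarnessLib

/-!
# `PeriodicStarCoercivity` (stmt-AtomisticToContinuum-13602): the registered transfer sub-goal and `13956 ⇒ 13602`

Route `ReggeStarCoercivity` (sub-problem `Crystallization` of `AtomisticToContinuum`), crux `PeriodicStarCoercivity`
(item 13602, filed `deps: StarCoercivity`), line `pinned-equilibria-reduction`.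

* `stub_blockTransfer` — the registered sub-goal `StarCoercivity → PeriodicStarCoercivity` (items 13600 ⇒ 13602, same
  constant `g`), discharged by the landed trial-block theorem `periodicStarCoercivity_of_starCoercivity`
  (`Theorems/ReggeStarCoercivityPeriodicStarCoercivityOfStarCoercivity.lean`, lead c1; the stubs T1–T3 of skeleton rev 5 —
  `stub_blockShell`, `stub_deepCount`, `stub_rpowBound` — are the same argument's ingredients, landed separately).
* `periodicStarCoercivity_of_coerciveTwoShellGap` — **13956 ⇒ 13602**: the sibling route's target
  `PhononSlackCertificates.CoerciveTwoShellGap` (item stmt-AtomisticToContinuum-13956) implies the torus crux, through the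
  landed `SeparationPaddingTransfer.stub_twoShellTransfer : CoerciveTwoShellGap → StarCoercivity` (13956 ⇒ 13600) and the
  block transfer. So a proof of EITHER 13600 or 13956 closes 13602 by modus ponens; conversely 13602 ⇒ 13600 is the landed
  `StarCoercivityPeriodisation.stub_periodicTransfer`, i.e. 13600 and 13602 are one statement in the tree.
All `[folklore]`; both theorems are CONDITIONAL only on their displayed hypotheses (open items 13600 / 13956).
-/

noncomputable section

namespace Summit.AtomisticToContinuum.Crystallization.Theorems.ReggeStarCoercivityPeriodicStarCoercivity

/-- **Registered sub-goal `stub_blockTransfer`** of crux stmt-AtomisticToContinuum-13602 (line `pinned-equilibria-reduction`,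
skeleton rev 5): `StarCoercivity → PeriodicStarCoercivity` with the same constant `g` — blocks of a periodic competitor
are finite near-competitors (`periodicStarCoercivity_of_starCoercivity`). CONDITIONAL on `StarCoercivity` (item 13600,
open). [folklore] -/
theorem stub_blockTransfer :
    Summit.AtomisticToContinuum.Crystallization.Theses.ReggeStarCoercivity.StarCoercivity →
      Summit.AtomisticToContinuum.Crystallization.Theses.ReggeStarCoercivity.PeriodicStarCoercivity :=
  periodicStarCoercivity_of_starCoercivity

/-- **13956 ⇒ 13602**: `PhononSlackCertificates.CoerciveTwoShellGap → ReggeStarCoercivity.PeriodicStarCoercivity`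
(instantiate the two-shell gap at separation `δ = 1/3` to get `StarCoercivity` —
`SeparationPaddingTransfer.stub_twoShellTransfer` — then transfer to the torus by blocks). CONDITIONAL on
`CoerciveTwoShellGap` (item 13956, open). [folklore] -/
theorem periodicStarCoercivity_of_coerciveTwoShellGap
    (h : Summit.AtomisticToContinuum.Crystallization.Theses.PhononSlackCertificates.CoerciveTwoShellGap) :
    Summit.AtomisticToContinuum.Crystallization.Theses.ReggeStarCoercivity.PeriodicStarCoercivity :=
  stub_blockTransfer (SeparationPaddingTransfer.stub_twoShellTransfer h)

end Summit.AtomisticToContinuum.Crystallization.Theorems.ReggeStarCoercivityPeriodicStarCoercivity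

end
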